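import Literature.NumberTheory.EllipticCurves.ModularCurve
import Literature.NumberTheory.EllipticCurves.ModularSymbolsProofs
import Literature.NumberTheory.EllipticCurves.HeckeOperatorsProofs
import Literature.NumberTheory.EllipticCurves.NewformsHeckeProofs
import HarnessLib

/-!
# Hecke correspondences and the Eichler integral: `T_p` acts on `ℂ/Λ_f` as `a_p(f)`

Topic `NumberTheory/EllipticCurves`; a proofs-only companion (theorems only: no definitions, no
named facts, nothing restated; D-0026) of `ModularSymbols.lean` / `ModularCurve.lean`, written by
the seat of the named fact `IsNewformOf.exists_maninConstant_ne_zero`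
(`ModularParametrizationDegree.lean`).

For a cusp form `h ∈ S₂(Γ₀(N))`, a prime `p` and `τ ∈ ℍ` write `u_h(τ) = 2πi∫_{i∞}^τ h(z) dz`
(the tree's `eichlerIntegral h τ = 2π ∫₀^∞ h(τ + it) dt`). The Hecke correspondence `T_p` on
`X₀(N)` sends the point `Γ₀(N)τ` to the divisor `∑_{j mod p} Γ₀(N)·(τ + j)/p + 𝟙_{p ∤ N} Γ₀(N)·pτ`
(Diamond–Shurman (5.2) and Prop. 5.2.1; Shimura (7.2.4)), and on cusp forms
`T_p h = ∑_j h ∣[2] (1 j; 0 p) + 𝟙_{p ∤ N} h ∣[2] diag(p, 1)` (the tree's theorem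
`coe_heckeT_gamma0_eq_sum`). We prove:

* `eichlerIntegral_heckeT_eq_sum` — **`u_{T_p h}(τ) = ∑_{j mod p} u_h((τ + j)/p) + 𝟙_{p ∤ N} u_h(pτ)`**
  for every `τ ∈ ℍ`: the maps `(1 j; 0 p)`, `diag(p, 1)` fix the cusp `i∞` and carry the vertical
  ray from `τ` onto the vertical ray from their image of `τ`, so this is the substitution
  `t ↦ t/p`, `t ↦ pt` in the defining integrals. This is Knapp's (11.97)–(11.99) (the
  endomorphism `t(n)` of `J₀(N)` induced by `T(n)` through `Φ̃(τ) = (∫_{τ₀}^τ f_j)ⱼ` has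
  differential `T₂(n)`, Prop. 11.73, Shimura–Taniyama) and the commutativity of Shimura's diagram
  (7.2.6), read on the one-dimensional quotient attached to `h` and with the base point `τ₀ = i∞`,
  where no constant of integration appears. (Its value at a cusp `τ → r ∈ ℚ` is the tree's
  `modularSymbol_heckeT_eq_sum`, Cremona (2.4.1)–(2.4.2); the present statement is the one on `ℍ`.)
* `IsNewform0.cuspCoeff_mul_eichlerIntegral` — for a newform `f`:
  **`a_p(f) u_f(τ) = ∑_j u_f((τ + j)/p) + 𝟙_{p ∤ N} u_f(pτ)`** (`T_p f = a_p(f) f`).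
* `map_eichlerIntegral_heckeT_of_cuspCoeff_eq_intCast` — pushed through any additive map
  `ψ : ℂ →+ A` (a complex torus `ℂ → ℂ/Λ`, the uniformisation `ℂ → E(ℂ)`), for `a_p(f) = a ∈ ℤ`:
  `a • ψ(c u_f(τ)) = ∑_j ψ(c u_f((τ + j)/p)) + 𝟙_{p ∤ N} ψ(c u_f(pτ))`; in particular on
  `E_f(ℂ) = ℂ/Λ_f` and on every torus `ℂ/Λ`, `(mk ∘ u_f)_* (T_p τ) = a_p(f) · mk(u_f(τ))`
  (`intCast_zsmul_mk_eichlerIntegral`). This is **Knapp, Thm. 11.74 (b)** ("the members `t(n)` of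
  `End J` act on the quotient `E` as multiplication by the integers `c_n`") and the commutative
  diagram **Diamond–Shurman (6.15)** (`J → J` by `T_p` over `A_f → A_f` by `a_p(f)`; "if `a_p(f)`
  lies in `ℤ` then indeed it acts as multiplication by itself"), i.e. Shimura, Thm. 7.14 (2)
  (`θ(a_n)` is the restriction of `ξ_n`), for the analytic model `ℂ/Λ_f` of `E_f` and at the level
  of points of `ℍ` (hence of divisors on `X₀(N)`).
* `IsNewformOf.lFunction_zsmul_φ` — for the tree's modular parametrisations
  `D : ModularParametrizationData W N` (`φ(τ) = uniformize (c · u_f(τ)) ∈ E(ℂ)`, `f` the newform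
  of `W`, so `a_p(f) = a_p(W) ∈ ℤ`): **`a_p(W) • φ(τ) = ∑_{j mod p} φ((τ + j)/p) + 𝟙_{p ∤ N} φ(pτ)`**
  in `E(ℂ)` — the Hecke-equivariance `φ ∘ T_p = [a_p] ∘ φ` of the modular parametrisation.

This characteristic-zero identity is one of the two inputs of the Eichler–Shimura congruence
relation `a_p(f) = a_p(E_f)` (Shimura Thm. 7.9 with Thm. 7.14 (2); Knapp Thm. 11.74 (e);
Diamond–Shurman Thm. 8.7.2), the open kernel of the tree's named fact `eichlerShimuraConstruction`
on which `IsNewformOf.exists_maninConstant_ne_zero` now rests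
(`PeriodLatticeRationalityUnconditionalProofs`, `ModularParametrizationResidualProofs`); the other
input (the reduction of `T_p` modulo `p` as Frobenius plus its transpose on `X₀(N)_{𝔽_p}`, Igusa)
is arithmetic-geometric and not touched here. It is also the relation behind the norm
compatibility of Heegner points along the parametrisation (Gross 1991, Prop. 3.7).

Everything is proved; no statement of the tree is changed; no definition and no named fact is
added.

## References

* A. W. Knapp, *Elliptic Curves*, Math. Notes 40, Princeton 1993: §XI.10, (11.95)–(11.99) and
  Prop. 11.73 (PDF pp. 285–286); Thm. 11.74 (b) (PDF p. 287). [Knapp1993]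
* G. Shimura, *Introduction to the arithmetic theory of automorphic functions*, Princeton 1971:
  §7.2, (7.2.4) and (7.2.6) (pp. 170–171 of the held scan, PDF pp. 196–197); Thm. 7.14 (2)
  (PDF p. 210). [ShimuraIATAF1971]
* F. Diamond, J. Shurman, *A First Course in Modular Forms*, GTM 228, Springer 2005: (5.2) and
  Prop. 5.2.1; §6.6, Def. 6.6.3 and diagram (6.15) (PDF pp. 267–268). [DiamondShurman2005]
* J. E. Cremona, *Algorithms for modular elliptic curves*, 2nd ed., CUP 1997, §2.4,
  (2.4.1)–(2.4.2); §2.10. [CremonaAlgorithms1997]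
-/

noncomputable section

open scoped MatrixGroups ModularForm

open CongruenceSubgroup Complex MeasureTheory Set Filter
open UpperHalfPlane hiding I

namespace Literature.NumberTheory.EllipticCurves.ModularForms

/-! ### The maps `(1 j; 0 p)`, `diag(p, 1)` on vertical rays in `ℍ` -/

section Rays

variable {N : ℕ} (p : ℕ) [NeZero p]

/-- `(1 j; 0 p) · (τ + it) = (1 j; 0 p)τ + i t/p` for `τ ∈ ℍ`, `t > 0`: the matrix `(1 j; 0 p)`
carries the vertical ray above `τ` onto the vertical ray above `(τ + j)/p` (twin of the tree's
`tpB_smul_ofComplex_ratCast`, there for a rational cusp `r` in place of `τ`). [folklore] -/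
theorem tpB_smul_ofComplex_coe (j : ℤ) (τ : ℍ) {t : ℝ} (ht : 0 < t) :
    tpB p j • ofComplex ((τ : ℂ) + t * I) =
      ofComplex (((tpB p j • τ : ℍ) : ℂ) + (t / p : ℝ) * I) := by
  have hp : (0 : ℝ) < p := by exact_mod_cast NeZero.pos p
  have h1 : 0 < ((τ : ℂ) + t * I).im := by
    have : ((τ : ℂ) + t * I).im = τ.im + t := by
      rw [add_im, UpperHalfPlane.coe_im, mul_im, ofReal_re, ofReal_im, Complex.I_re,
        Complex.I_im]; ring
    rw [this]; exact add_pos τ.im_pos ht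
  have h2 : 0 < (((tpB p j • τ : ℍ) : ℂ) + (t / p : ℝ) * I).im := by
    have : (((tpB p j • τ : ℍ) : ℂ) + (t / p : ℝ) * I).im = (tpB p j • τ).im + t / p := by
      rw [add_im, UpperHalfPlane.coe_im, mul_im, ofReal_re, ofReal_im, Complex.I_re,
        Complex.I_im]; ring
    rw [this]; exact add_pos (tpB p j • τ).im_pos (by positivity)
  ext1
  rw [coe_tpB_smul, ofComplex_apply_of_im_pos h1, ofComplex_apply_of_im_pos h2,
    UpperHalfPlane.coe_mk _ h1, UpperHalfPlane.coe_mk _ h2, coe_tpB_smul]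
  push_cast
  field_simp
  ring

/-- `diag(p, 1) · (τ + it) = pτ + i pt` for `τ ∈ ℍ`, `t > 0`: `diag(p, 1)` carries the vertical
ray above `τ` onto the vertical ray above `pτ` (twin of `tpD_smul_ofComplex_ratCast`). [folklore] -/
theorem tpD_smul_ofComplex_coe (τ : ℍ) {t : ℝ} (ht : 0 < t) :
    tpD p • ofComplex ((τ : ℂ) + t * I) =
      ofComplex (((tpD p • τ : ℍ) : ℂ) + (p * t : ℝ) * I) := by
  have hp : (0 : ℝ) < p := by exact_mod_cast NeZero.pos p
  have h1 : 0 < ((τ : ℂ) + t * I).im := by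
    have : ((τ : ℂ) + t * I).im = τ.im + t := by
      rw [add_im, UpperHalfPlane.coe_im, mul_im, ofReal_re, ofReal_im, Complex.I_re,
        Complex.I_im]; ring
    rw [this]; exact add_pos τ.im_pos ht
  have h2 : 0 < (((tpD p • τ : ℍ) : ℂ) + (p * t : ℝ) * I).im := by
    have : (((tpD p • τ : ℍ) : ℂ) + (p * t : ℝ) * I).im = (tpD p • τ).im + p * t := by
      rw [add_im, UpperHalfPlane.coe_im, mul_im, ofReal_re, ofReal_im, Complex.I_re,
        Complex.I_im]; ring
    rw [this]; exact add_pos (tpD p • τ).im_pos (by positivity)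
  ext1
  rw [coe_tpD_smul, ofComplex_apply_of_im_pos h1, ofComplex_apply_of_im_pos h2,
    UpperHalfPlane.coe_mk _ h1, UpperHalfPlane.coe_mk _ h2, coe_tpD_smul]
  push_cast
  ring

variable (h : CuspForm (Gamma0 N) 2)

/-- `(h ∣[2] (1 j; 0 p))(τ + it) = p⁻¹ h((1 j; 0 p)τ + i t/p)` for `t > 0`
(Diamond–Shurman, proof of Prop. 5.2.2: `(h ∣[2] (1 j; 0 p))(z) = p⁻¹ h((z + j)/p)`). [folklore] -/
theorem slash_tpB_ofComplex_coe (j : ℤ) (τ : ℍ) {t : ℝ} (ht : 0 < t) :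
    (⇑h ∣[(2 : ℤ)] tpB p j) (ofComplex ((τ : ℂ) + t * I)) =
      (p : ℂ)⁻¹ * h (ofComplex (((tpB p j • τ : ℍ) : ℂ) + ((p : ℝ)⁻¹ * t : ℝ) * I)) := by
  rw [slash_tpB_apply, tpB_smul_ofComplex_coe p j τ ht]
  congr 4
  push_cast
  ring

/-- `(h ∣[2] diag(p, 1))(τ + it) = p h(pτ + i pt)` for `t > 0`
(Diamond–Shurman, proof of Prop. 5.2.2: `(h ∣[2] diag(p, 1))(z) = p h(pz)`). [folklore] -/
theorem slash_tpD_ofComplex_coe (τ : ℍ) {t : ℝ} (ht : 0 < t) :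
    (⇑h ∣[(2 : ℤ)] tpD p) (ofComplex ((τ : ℂ) + t * I)) =
      (p : ℂ) * h (ofComplex (((tpD p • τ : ℍ) : ℂ) + ((p : ℝ) * t : ℝ) * I)) := by
  rw [slash_tpD_apply, tpD_smul_ofComplex_coe p τ ht]
  norm_num

/-- **`2π ∫₀^∞ (h ∣[2] (1 j; 0 p))(τ + it) dt = u_h((τ + j)/p)`**: the substitution `s = t/p`
(Knapp (11.98)–(11.99) for `α_i = (1 j; 0 p)`, base point `i∞`; Cremona (2.4.1)–(2.4.2)).
[cite: Knapp1993, (11.98)–(11.99)] -/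
theorem eichlerIntegral_slash_tpB (j : ℤ) (τ : ℍ) :
    2 * Real.pi * ∫ t in Ioi (0 : ℝ), (⇑h ∣[(2 : ℤ)] tpB p j) (ofComplex ((τ : ℂ) + t * I)) =
      eichlerIntegral h (tpB p j • τ) := by
  have hp : (0 : ℝ) < p := by exact_mod_cast NeZero.pos p
  rw [eichlerIntegral]
  congr 1
  set G : ℝ → ℂ := fun s ↦ h (ofComplex (((tpB p j • τ : ℍ) : ℂ) + s * I))
  have hI : ∀ t ∈ Ioi (0 : ℝ), (⇑h ∣[(2 : ℤ)] tpB p j) (ofComplex ((τ : ℂ) + t * I)) =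
      (p : ℂ)⁻¹ * G ((p : ℝ)⁻¹ * t) := fun t ht ↦ slash_tpB_ofComplex_coe p h j τ ht
  rw [setIntegral_congr_fun measurableSet_Ioi hI, integral_const_mul,
    integral_comp_mul_left_Ioi G 0 (inv_pos.mpr hp), mul_zero, inv_inv, Complex.real_smul,
    ofReal_natCast, ← mul_assoc,
    inv_mul_cancel₀ (show (p : ℂ) ≠ 0 by exact_mod_cast NeZero.ne p), one_mul]

/-- **`2π ∫₀^∞ (h ∣[2] diag(p, 1))(τ + it) dt = u_h(pτ)`**: the substitution `s = pt`
(Knapp (11.98)–(11.99) for `α_i = diag(p, 1)`, base point `i∞`; Cremona (2.4.1)–(2.4.2)).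
[cite: Knapp1993, (11.98)–(11.99)] -/
theorem eichlerIntegral_slash_tpD (τ : ℍ) :
    2 * Real.pi * ∫ t in Ioi (0 : ℝ), (⇑h ∣[(2 : ℤ)] tpD p) (ofComplex ((τ : ℂ) + t * I)) =
      eichlerIntegral h (tpD p • τ) := by
  have hp : (0 : ℝ) < p := by exact_mod_cast NeZero.pos p
  rw [eichlerIntegral]
  congr 1
  set G : ℝ → ℂ := fun s ↦ h (ofComplex (((tpD p • τ : ℍ) : ℂ) + s * I))
  have hI : ∀ t ∈ Ioi (0 : ℝ), (⇑h ∣[(2 : ℤ)] tpD p) (ofComplex ((τ : ℂ) + t * I)) =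
      (p : ℂ) * G (p * t) := fun t ht ↦ slash_tpD_ofComplex_coe p h τ ht
  rw [setIntegral_congr_fun measurableSet_Ioi hI, integral_const_mul,
    integral_comp_mul_left_Ioi G 0 hp, mul_zero, Complex.real_smul, ofReal_inv, ofReal_natCast,
    ← mul_assoc, mul_inv_cancel₀ (show (p : ℂ) ≠ 0 by exact_mod_cast NeZero.ne p), one_mul]

variable [NeZero N]

/-- `t ↦ (h ∣[2] (1 j; 0 p))(τ + it)` is integrable on `(0, ∞)` (from the integrability of
`t ↦ h(τ' + it)`, `integrableOn_eichlerIntegral_integrand_holds`, by `t ↦ t/p`). [folklore] -/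
theorem integrableOn_slash_tpB_coe (j : ℤ) (τ : ℍ) :
    IntegrableOn (fun t : ℝ ↦ (⇑h ∣[(2 : ℤ)] tpB p j) (ofComplex ((τ : ℂ) + t * I))) (Ioi 0) := by
  have hp : (0 : ℝ) < p := by exact_mod_cast NeZero.pos p
  set G : ℝ → ℂ := fun s ↦ h (ofComplex (((tpB p j • τ : ℍ) : ℂ) + s * I))
  have hG : IntegrableOn G (Ioi 0) := integrableOn_eichlerIntegral_integrand_holds h _
  have hG' : IntegrableOn (fun t ↦ G ((p : ℝ)⁻¹ * t)) (Ioi 0) :=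
    (integrableOn_Ioi_comp_mul_left_iff G 0 (inv_pos.mpr hp)).mpr (by simpa using hG)
  refine IntegrableOn.congr_fun (hG'.const_mul ((p : ℂ)⁻¹)) (fun t ht ↦ ?_) measurableSet_Ioi
  exact (slash_tpB_ofComplex_coe p h j τ ht).symm

/-- `t ↦ (h ∣[2] diag(p, 1))(τ + it)` is integrable on `(0, ∞)` (by `t ↦ pt`). [folklore] -/
theorem integrableOn_slash_tpD_coe (τ : ℍ) :
    IntegrableOn (fun t : ℝ ↦ (⇑h ∣[(2 : ℤ)] tpD p) (ofComplex ((τ : ℂ) + t * I))) (Ioi 0) := by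
  have hp : (0 : ℝ) < p := by exact_mod_cast NeZero.pos p
  set G : ℝ → ℂ := fun s ↦ h (ofComplex (((tpD p • τ : ℍ) : ℂ) + s * I))
  have hG : IntegrableOn G (Ioi 0) := integrableOn_eichlerIntegral_integrand_holds h _
  have hG' : IntegrableOn (fun t ↦ G ((p : ℝ) * t)) (Ioi 0) :=
    (integrableOn_Ioi_comp_mul_left_iff G 0 hp).mpr (by simpa using hG)
  refine IntegrableOn.congr_fun (hG'.const_mul (p : ℂ)) (fun t ht ↦ ?_) measurableSet_Ioi
  exact (slash_tpD_ofComplex_coe p h τ ht).symm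

end Rays

/-! ### `u_{T_p h}(τ) = ∑ⱼ u_h((τ + j)/p) + 𝟙_{p ∤ N} u_h(pτ)` -/

section Hecke

variable {N : ℕ} [NeZero N] (p : ℕ) [NeZero p] (h : CuspForm (Gamma0 N) 2)

omit [NeZero N] [NeZero p] in
/-- `u_{c • h}(τ) = c u_h(τ)`. [folklore] -/
theorem eichlerIntegral_const_smul (c : ℂ) (τ : ℍ) :
    eichlerIntegral (c • h) τ = c * eichlerIntegral h τ := by
  have hc : ∀ z : ℍ, (c • h) z = c * h z := fun z ↦ rfl
  simp only [eichlerIntegral, hc]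
  rw [integral_const_mul]
  ring

/-- **Hecke correspondences and the Eichler integral** (Knapp 1993, (11.97)–(11.99) with
Prop. 11.73; Shimura 1971, (7.2.4) and (7.2.6)): for a prime `p`, `h ∈ S₂(Γ₀(N))` and `τ ∈ ℍ`,
`u_{T_p h}(τ) = ∑_{j mod p} u_h((τ + j)/p) + 𝟙_{p ∤ N} u_h(pτ)`, where `u_h(τ) = 2πi∫_{i∞}^τ h`:
`T_p h = ∑_j h ∣[2] (1 j; 0 p) + 𝟙_{p ∤ N} h ∣[2] diag(p, 1)` (`coe_heckeT_gamma0_eq_sum`,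
Diamond–Shurman Prop. 5.2.1) and `2πi∫_{i∞}^τ h ∣[2] α = 2πi∫_{i∞}^{ατ} h` for the affine maps
`α = (1 j; 0 p), diag(p, 1)`, which fix the cusp `i∞` (`eichlerIntegral_slash_tpB/_tpD`). All
primes are covered (`T_p = U_p` for `p ∣ N`). The value at a rational cusp is the tree's
`modularSymbol_heckeT_eq_sum` (Cremona (2.4.1)–(2.4.2)). [cite: Knapp1993, (11.97)–(11.99) and Prop. 11.73] -/
theorem eichlerIntegral_heckeT_eq_sum (hp : p.Prime) (τ : ℍ) :
    eichlerIntegral (heckeT (Gamma0 N) 2 p h) τ =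
      ∑ j : Fin p, eichlerIntegral h (tpB p ((j : ℕ) : ℤ) • τ) +
        if p ∣ N then 0 else eichlerIntegral h (tpD p • τ) := by
  have hL : eichlerIntegral (heckeT (Gamma0 N) 2 p h) τ =
      2 * Real.pi * ∫ t in Ioi (0 : ℝ),
        (∑ j : Fin p, ⇑h ∣[(2 : ℤ)] tpB p ((j : ℕ) : ℤ) + if p ∣ N then 0 else ⇑h ∣[(2 : ℤ)] tpD p)
          (ofComplex ((τ : ℂ) + t * I)) := by
    rw [eichlerIntegral, coe_heckeT_gamma0_eq_sum N 2 p hp h]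
  rw [hL]
  by_cases hpN : p ∣ N
  · simp only [if_pos hpN, add_zero, Finset.sum_apply]
    rw [integral_finsetSum _ (fun j _ ↦ integrableOn_slash_tpB_coe p h _ τ), Finset.mul_sum]
    exact Finset.sum_congr rfl fun j _ ↦ eichlerIntegral_slash_tpB p h _ τ
  · simp only [if_neg hpN, Pi.add_apply, Finset.sum_apply]
    rw [integral_add (integrable_finsetSum _ (fun j _ ↦ integrableOn_slash_tpB_coe p h _ τ))
      (integrableOn_slash_tpD_coe p h τ), mul_add,
      integral_finsetSum _ (fun j _ ↦ integrableOn_slash_tpB_coe p h _ τ), Finset.mul_sum,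
      eichlerIntegral_slash_tpD p h τ]
    congr 1
    exact Finset.sum_congr rfl fun j _ ↦ eichlerIntegral_slash_tpB p h _ τ

/-- **`a_p(f) u_f(τ) = ∑_{j mod p} u_f((τ + j)/p) + 𝟙_{p ∤ N} u_f(pτ)` for a newform `f`** and
every prime `p` (Knapp 1993, Thm. 11.74 (b) for `E_f = ℂ/Λ_f` at the level of `ℍ`;
Diamond–Shurman (6.15)): `T_p f = a_p(f) f` (`IsNewform0.heckeT_eq_coeff_smul`, Diamond–Shurman
Prop. 5.8.5) in `eichlerIntegral_heckeT_eq_sum`. [cite: Knapp1993, Thm. 11.74 (b)] -/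
theorem IsNewform0.cuspCoeff_mul_eichlerIntegral {f : CuspForm (Gamma0 N) 2} (hf : IsNewform0 f)
    (hp : p.Prime) (τ : ℍ) :
    cuspCoeff f p * eichlerIntegral f τ =
      ∑ j : Fin p, eichlerIntegral f (tpB p ((j : ℕ) : ℤ) • τ) +
        if p ∣ N then 0 else eichlerIntegral f (tpD p • τ) := by
  rw [← eichlerIntegral_heckeT_eq_sum p f hp τ, hf.heckeT_eq_coeff_smul hp,
    eichlerIntegral_const_smul]
  rfl

/-- The case `p ∤ N`: `a_p(f) u_f(τ) = ∑_{j mod p} u_f((τ + j)/p) + u_f(pτ)`.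
[cite: Knapp1993, Thm. 11.74 (b)] -/
theorem IsNewform0.cuspCoeff_mul_eichlerIntegral_of_not_dvd {f : CuspForm (Gamma0 N) 2}
    (hf : IsNewform0 f) (hp : p.Prime) (hpN : ¬ p ∣ N) (τ : ℍ) :
    cuspCoeff f p * eichlerIntegral f τ =
      ∑ j : Fin p, eichlerIntegral f (tpB p ((j : ℕ) : ℤ) • τ) + eichlerIntegral f (tpD p • τ) := by
  rw [hf.cuspCoeff_mul_eichlerIntegral p hp τ, if_neg hpN]

/-- The case `p ∣ N` (`T_p = U_p`): `a_p(f) u_f(τ) = ∑_{j mod p} u_f((τ + j)/p)`.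
[cite: Knapp1993, Thm. 11.74 (b)] -/
theorem IsNewform0.cuspCoeff_mul_eichlerIntegral_of_dvd {f : CuspForm (Gamma0 N) 2}
    (hf : IsNewform0 f) (hp : p.Prime) (hpN : p ∣ N) (τ : ℍ) :
    cuspCoeff f p * eichlerIntegral f τ =
      ∑ j : Fin p, eichlerIntegral f (tpB p ((j : ℕ) : ℤ) • τ) := by
  rw [hf.cuspCoeff_mul_eichlerIntegral p hp τ, if_pos hpN, add_zero]

/-! ### On tori `ℂ/Λ` and on `E(ℂ)`: `T_p` acts as multiplication by the integer `a_p` -/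

/-- **`T_p` acts through `a_p(f) ∈ ℤ` on every additive image of the Eichler integral**
(Knapp 1993, Thm. 11.74 (b); Diamond–Shurman §6.6, (6.15): "if `a_p(f)` lies in `ℤ` then indeed
it acts as multiplication by itself"): for a newform `f` with `a_p(f) = a ∈ ℤ`, an additive map
`ψ : ℂ →+ A` (e.g. `ℂ → ℂ/Λ`, or the uniformisation `ℂ → E(ℂ)`) and a scalar `c`,
`a • ψ(c u_f(τ)) = ∑_{j mod p} ψ(c u_f((τ + j)/p)) + 𝟙_{p ∤ N} ψ(c u_f(pτ))`.
[cite: DiamondShurman2005, §6.6 (6.15)] -/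
theorem IsNewform0.zsmul_map_eichlerIntegral_of_cuspCoeff_eq_intCast {A : Type*} [AddCommGroup A]
    (ψ : ℂ →+ A) {f : CuspForm (Gamma0 N) 2} (hf : IsNewform0 f) (hp : p.Prime) {a : ℤ}
    (ha : cuspCoeff f p = a) (c : ℂ) (τ : ℍ) :
    a • ψ (c * eichlerIntegral f τ) =
      ∑ j : Fin p, ψ (c * eichlerIntegral f (tpB p ((j : ℕ) : ℤ) • τ)) +
        if p ∣ N then 0 else ψ (c * eichlerIntegral f (tpD p • τ)) := by
  have key := hf.cuspCoeff_mul_eichlerIntegral p hp τ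
  rw [ha] at key
  have hz : a • ψ (c * eichlerIntegral f τ) = ψ (c * ((a : ℂ) * eichlerIntegral f τ)) := by
    rw [← map_zsmul ψ, zsmul_eq_mul]
    congr 1
    ring
  rw [hz, key, mul_add, map_add, Finset.mul_sum, map_sum]
  congr 1
  split_ifs <;> simp

/-- **`T_p` acts on the torus `ℂ/Λ` as multiplication by `a_p(f)`** (any additive subgroup `Λ`,
in particular `Λ = Λ_f`, the analytic `E_f(ℂ) = ℂ/Λ_f` of Knapp Thm. 11.74 (d)): for a newform `f`
with `a_p(f) = a ∈ ℤ`, `a • [u_f(τ)] = ∑_{j mod p} [u_f((τ + j)/p)] + 𝟙_{p ∤ N} [u_f(pτ)]` in `ℂ/Λ`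
(Knapp 1993, Thm. 11.74 (b); Diamond–Shurman (6.15); Shimura 1971, Thm. 7.14 (2)).
[cite: Knapp1993, Thm. 11.74 (b)] -/
theorem IsNewform0.zsmul_mk_eichlerIntegral_of_cuspCoeff_eq_intCast (Λ : AddSubgroup ℂ)
    {f : CuspForm (Gamma0 N) 2} (hf : IsNewform0 f) (hp : p.Prime) {a : ℤ}
    (ha : cuspCoeff f p = a) (τ : ℍ) :
    a • (QuotientAddGroup.mk (eichlerIntegral f τ) : ℂ ⧸ Λ) =
      ∑ j : Fin p, (QuotientAddGroup.mk (eichlerIntegral f (tpB p ((j : ℕ) : ℤ) • τ)) : ℂ ⧸ Λ) +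
        if p ∣ N then 0 else (QuotientAddGroup.mk (eichlerIntegral f (tpD p • τ)) : ℂ ⧸ Λ) := by
  have H := hf.zsmul_map_eichlerIntegral_of_cuspCoeff_eq_intCast p (QuotientAddGroup.mk' Λ) hp ha
    1 τ
  simpa only [one_mul, QuotientAddGroup.mk'_apply] using H

/-- **`a_p(W) u_f(τ) = ∑_{j mod p} u_f((τ + j)/p) + 𝟙_{p ∤ N} u_f(pτ)`** for the newform `f` of a
Weierstrass curve `W/ℚ` (`IsNewformOf W f`: `aₙ(f) = aₙ(W)`, the Dirichlet coefficients of
Mathlib's `W.LFunction`), every prime `p` and `τ ∈ ℍ`. [cite: Knapp1993, Thm. 11.74 (b)] -/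
theorem IsNewformOf.lFunction_mul_eichlerIntegral {W : WeierstrassCurve ℚ} {f : CuspForm (Gamma0 N) 2}
    (hW : IsNewformOf W f) (hp : p.Prime) (τ : ℍ) :
    (W.LFunction p : ℂ) * eichlerIntegral f τ =
      ∑ j : Fin p, eichlerIntegral f (tpB p ((j : ℕ) : ℤ) • τ) +
        if p ∣ N then 0 else eichlerIntegral f (tpD p • τ) := by
  rw [← hW.2 p]
  exact hW.1.cuspCoeff_mul_eichlerIntegral p hp τ

/-- **Hecke-equivariance of the modular parametrisation, `φ ∘ T_p = [a_p(W)] ∘ φ`** (Knapp 1993,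
Thm. 11.74 (b): "the members `t(n)` of `End J` ... act on the quotient `E` as multiplication by
the integers `c_n`"; Diamond–Shurman (6.15); Shimura 1971, Thm. 7.14 (2)): for a modular
parametrisation datum `D` of `W/ℚ` (`φ(τ) = uniformize (c · 2πi∫_{i∞}^τ f) ∈ E(ℂ)`, `f` the newform
of `W`) and a prime `p`,
`a_p(W) • φ(τ) = ∑_{j mod p} φ((τ + j)/p) + 𝟙_{p ∤ N} φ(pτ)` in the group `E(ℂ)`.
[cite: Knapp1993, Thm. 11.74 (b)] -/
theorem ModularParametrizationData.lFunction_zsmul_φ {W : WeierstrassCurve ℚ}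
    (D : ModularParametrizationData W N) (hp : p.Prime) (τ : ℍ) :
    W.LFunction p • D.φ τ =
      ∑ j : Fin p, D.φ (tpB p ((j : ℕ) : ℤ) • τ) + if p ∣ N then 0 else D.φ (tpD p • τ) := by
  have ha : cuspCoeff D.f p = ((W.LFunction p : ℤ) : ℂ) := D.isNewformOf.2 p
  exact D.isNewformOf.1.zsmul_map_eichlerIntegral_of_cuspCoeff_eq_intCast p D.uniformize hp ha
    (D.c : ℂ) τ

/-- The case `p ∤ N` of `ModularParametrizationData.lFunction_zsmul_φ`:
`a_p(W) • φ(τ) = ∑_{j mod p} φ((τ + j)/p) + φ(pτ)` — the form entering the Eichler–Shimura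
congruence relation at the good primes (Knapp Thm. 11.74 (b), (e)). [cite: Knapp1993, Thm. 11.74 (b)] -/
theorem ModularParametrizationData.lFunction_zsmul_φ_of_not_dvd {W : WeierstrassCurve ℚ}
    (D : ModularParametrizationData W N) (hp : p.Prime) (hpN : ¬ p ∣ N) (τ : ℍ) :
    W.LFunction p • D.φ τ = ∑ j : Fin p, D.φ (tpB p ((j : ℕ) : ℤ) • τ) + D.φ (tpD p • τ) := by
  rw [D.lFunction_zsmul_φ p hp τ, if_neg hpN]

end Hecke

end Literature.NumberTheory.EllipticCurves.ModularForms
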